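import Mathlib
import HarnessLib
import Summits.NavierStokesRegularity.NavierStokesRegularity.Theorems.QuarterLogPincerThinCascadeDefs
import Summits.NavierStokesRegularity.NavierStokesRegularity.Theorems.QuarterLogPincerTruncationEdgeDefs
import Summits.NavierStokesRegularity.NavierStokesRegularity.Theorems.QuarterLogPincerTruncationEdgeAnatomyDefs
import Summits.NavierStokesRegularity.NavierStokesRegularity.Theorems.QuarterLogPincerTruncationEdgeFrameBootstrap
import Summits.NavierStokesRegularity.NavierStokesRegularity.Theorems.QuarterLogPincerQuietCollarDefs
import Summits.NavierStokesRegularity.NavierStokesRegularity.Theorems.QuarterLogPincerQuietCollarShadowing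
import Summits.NavierStokesRegularity.NavierStokesRegularity.Theorems.QuarterLogPincerQuietCollarDefsLog
import Summits.NavierStokesRegularity.NavierStokesRegularity.Theorems.QuarterLogPincerQuietCollarLeverLog
import Summits.NavierStokesRegularity.NavierStokesRegularity.Theorems.QuarterLogPincerQuietCollarCutPair
import Literature.Analysis.FluidPDE.TypeIAncientMild
import Literature.Analysis.FluidPDE.DyadicChaining

/-!
# Route `QuarterLogPincer`, crux `TypeIQuantSubcubicExp` (stmt-NavierStokesRegularity-24077), line `quiet_collar` —
# Q1 `StubQuietTruncation` BY NAME, from the log-weighted pieces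

The Q1 ANATOMY of ns-idea-7's LOOP line `quiet_collar` (tree `Cruxes/TypeIQuantSubcubicExp/Lines/quiet_collar.lean`
v1.4+, `farFieldTruncation_of_quietAnatomy : QP1 → QP2 → QP3 → P2 → FarFieldTruncation M v`, kernel-checked by the author)
consumes QP1's quiet collar VERBATIM as QP2's collar hypothesis and otherwise only the conclusions of QP2.  In the
log-weighted typing of the pub-ns-dss typer's audit (`…QuietCollarDefsLog`: collar level `ηq/(1+Real.log r)` on BOTH
sides) the two sides still match verbatim, so the author's composition body goes through UNCHANGED with
`(h1 : QuietCollarLog v) (h2 : CutPairLog v)`; since QP1-log (`stub_quietCollarLog`, `…QuietCollarLeverLog`), QP2-log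
(`stub_cutPairLog`, `…QuietCollarCutPair`), QP3 (`stub_forcedTwoNormShadowing`, `…QuietCollarShadowing`) and P2
(`TruncationEdge.stub_frameBootstrap`, `…TruncationEdgeFrameBootstrap`) are tree theorems by name, **Q1
`StubQuietTruncation` (`…QuietCollarDefs`) is a tree theorem by name: `stub_quietTruncation_log`.**

* `farFieldTruncation_of_quietAnatomyLog` — the author's `farFieldTruncation_of_quietAnatomy` (quiet_collar.lean v1.4,
  ll. 835–1070, ns-idea-7 g9/g10) with the two piece hypotheses re-typed; body BYTE-IDENTICAL.
* `stubQuietTruncation_of_anatomyLog`, ★ `stub_quietTruncation_log : StubQuietTruncation`.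

With Q1 by name, the line's EDGE `logCubeFloorLiouville_of_typeIQuantSubcubicExp : Q1 → 24077 → LogCubeFloorLiouville`
loses its Q1 hypothesis (the author's rebase; not restated here).  HONEST FRAME: statements about HYPOTHETICAL Type-I
ancient mild fields; the loop line identifies 24077 with a log-cube Liouville statement and attacks no wall; Q2, Q3,
24077, 22144, W7 and Navier–Stokes regularity are OPEN / not proved.  pub-ns-dss typer (g37),
`--supports stmt-NavierStokesRegularity-24077`; composition body by ns-idea-7 (verbatim port).
-/

noncomputable section

set_option linter.dupNamespace false

namespace Summit.NavierStokesRegularity.NavierStokesRegularity.Cruxes.TypeIQuantSubcubicExp.QuietCollar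

open MeasureTheory Set Function Metric Filter Topology
open scoped ENNReal NNReal
open Literature.Analysis Literature.Analysis.FluidPDE
open Summit.NavierStokesRegularity.NavierStokesRegularity.Cruxes.TypeIQuantSubcubicExp.ThinCascade
  (TaoFrame ThinObject SingularAt)
open Summit.NavierStokesRegularity.NavierStokesRegularity.Cruxes.TypeIQuantSubcubicExp.TruncationEdge
  (FarFieldTruncation EnvelopeCubeBudget FrameBootstrap StubFrameBootstrap stub_frameBootstrap)

set_option maxHeartbeats 1600000 in
/-- **Q1 FROM ITS LOG-WEIGHTED ANATOMY (PROVED): QP1-log → QP2-log → QP3 → P2 → `FarFieldTruncation M v`** for a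
Type-I ancient mild field with the log-cube budget, at the SAME rate constant `M`.  The author's
`farFieldTruncation_of_quietAnatomy` (quiet_collar.lean ll. 835–1070) with `(h1 : QuietCollarLog v) (h2 : CutPairLog v)`;
body byte-identical (QP1's collar is fed verbatim into QP2's hypothesis; only QP2's conclusions are used afterwards).
[line quiet_collar, ns-idea-7; port pub-ns-dss typer] -/
theorem farFieldTruncation_of_quietAnatomyLog {M : ℝ}
    {v : ℝ → EuclideanSpace ℝ (Fin 3) → EuclideanSpace ℝ (Fin 3)}
    (hv : IsTypeIAncientMild M v) (hB : EnvelopeCubeBudget v)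
    (h1 : QuietCollarLog v) (h2 : CutPairLog v) (h3 : ForcedTwoNormShadowing) (h4 : FrameBootstrap) :
    FarFieldTruncation M v := by
  intro δ hδ hδ1
  -- the rate constant is nonnegative
  have hM : 0 ≤ M := by
    have h := hv.2.2.2 (-1) (by norm_num) 0
    rw [neg_neg, Real.sqrt_one, div_one] at h
    exact (norm_nonneg _).trans h
  -- QP3 constants (depend on M only)
  obtain ⟨κ₃, K₃, hκ₃, hK₃, hsh⟩ := h3 M hM
  have hK₃pos : 0 < K₃ := by linarith
  -- the sup target η₁ ε^{κ₃}, η₁ = δ/(2K₃)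
  set η₁ : ℝ := δ / (2 * K₃) with hη₁
  have hη₁pos : 0 < η₁ := by positivity
  have hη₁le : η₁ ≤ δ / 2 := by
    rw [hη₁]
    exact div_le_div_of_nonneg_left hδ.le (by norm_num) (by linarith)
  -- QP2 constants for this target, QP1 constants for QP2's requests
  obtain ⟨k₂, K₂, hk₂, hK₂, hcut⟩ := h2 η₁ κ₃ hη₁pos hκ₃
  obtain ⟨κ₁, K₁, hκ₁, hK₁, hcol⟩ := h1 k₂ K₂ hk₂ hK₂
  -- the budget constant
  obtain ⟨B, hB0, hbud⟩ := hB
  -- constants of Q1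
  set c : ℝ := K₃ * (K₂ + 2) with hc
  have hcpos : 1 ≤ c := by
    have : (1 : ℝ) ≤ K₂ + 2 := by linarith
    calc (1 : ℝ) = 1 * 1 := by ring
      _ ≤ K₃ * (K₂ + 2) := mul_le_mul hK₃ this zero_le_one (by linarith)
  refine ⟨k₂ + (κ₁ + κ₁), max (K₂ * (K₁ * K₁)) (4 * (B + 1) * c ^ 3), by positivity, ?_, ?_⟩
  · refine le_max_of_le_right ?_
    have h1 : (1 : ℝ) ≤ c ^ 3 := one_le_pow₀ hcpos
    have h2 : (1 : ℝ) ≤ 4 * (B + 1) := by linarith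
    calc (1 : ℝ) = 1 * 1 := by ring
      _ ≤ 4 * (B + 1) * c ^ 3 := mul_le_mul h2 h1 zero_le_one (by linarith)
  intro ε hε
  have hεpos : 0 < ε := hε.1
  have hεhalf : ε ≤ 1 / 2 := hε.2
  have hεlt1 : ε < 1 := by linarith
  -- QP2's requests at ε, QP1's collar, QP2's cut pair
  obtain ⟨ηq, Lq, hηq, hLq, hLqK, hpair⟩ := hcut ε hε
  obtain ⟨r, hr2, hrK, hquiet⟩ := hcol ε hε ηq Lq hηq hLq hLqK
  obtain ⟨R, V, u₀, hRlo, hRhi, hu₀s, hu₀d, hu₀c, hdata, hVcont, hVle, hVzero, hVeq, hVL3, hdef, hL3⟩ :=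
    hpair r hr2 hquiet
  have hrpos : 0 < r := by linarith
  have hR2 : 2 ≤ R := by linarith
  -- the slab
  set T : ℝ := 1 - ε with hT
  have hTpos : 0 < T := by rw [hT]; linarith
  have hTlt : T < 1 := by rw [hT]; linarith
  -- the sup accuracy: K₃ ε^{-κ₃} (η₁ ε^{κ₃}) = δ/2
  have hεκ₃pos : 0 < ε ^ κ₃ := Real.rpow_pos_of_pos hεpos _
  have hεκ₃ : ε ^ κ₃ ≤ 1 := Real.rpow_le_one hεpos.le hεlt1.le hκ₃
  have hηpos : 0 < η₁ * ε ^ κ₃ := mul_pos hη₁pos hεκ₃pos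
  have hηle : η₁ * ε ^ κ₃ ≤ δ / 2 := (mul_le_of_le_one_right hη₁pos.le hεκ₃).trans hη₁le
  have hδw : K₃ * ε ^ (-κ₃) * (η₁ * ε ^ κ₃) = δ / 2 := by
    rw [Real.rpow_neg hεpos.le, hη₁]
    field_simp
  -- rate and boundedness of V
  have hVrate : ∀ t ∈ Icc 0 T, ∀ x, ‖V t x‖ ≤ M * (1 - t) ^ (-(1 / 2 : ℝ)) := by
    intro t ht x
    have h1t : 0 < 1 - t := by rw [hT] at ht; linarith [ht.2]
    have h := hv.2.2.2 (t - 1) (by linarith) x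
    have hneg : -(t - 1) = 1 - t := by ring
    rw [hneg, Real.sqrt_eq_rpow, div_eq_mul_inv, ← Real.rpow_neg h1t.le] at h
    exact (hVle t ht x).trans h
  have hsqε : 0 < Real.sqrt ε := Real.sqrt_pos.2 hεpos
  have hVbd : ∃ B' : ℝ, ∀ t ∈ Icc 0 T, ∀ x, ‖V t x‖ ≤ B' := by
    refine ⟨M / Real.sqrt ε, fun t ht x => (hVle t ht x).trans ?_⟩
    have h := hv.2.2.2 (t - 1) (by rw [hT] at ht; linarith [ht.2]) x
    refine h.trans ?_
    have hneg : -(t - 1) = 1 - t := by ring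
    rw [hneg]
    have hsq : Real.sqrt ε ≤ Real.sqrt (1 - t) := by
      apply Real.sqrt_le_sqrt; rw [hT] at ht; linarith [ht.2]
    exact div_le_div_of_nonneg_left hM hsqε hsq
  have hVdec : ∀ η : ℝ, 0 < η → ∃ R' : ℝ, ∀ t ∈ Icc 0 T, ∀ x : EuclideanSpace ℝ (Fin 3),
      R' ≤ ‖x‖ → ‖V t x‖ ≤ η := by
    intro η hη
    exact ⟨R, fun t ht x hx => by rw [hVzero t ht x hx, norm_zero]; exact hη.le⟩
  have hVzero' : ∃ R' : ℝ, ∀ t ∈ Icc 0 (1 - ε), ∀ x : EuclideanSpace ℝ (Fin 3), R' ≤ ‖x‖ → V t x = 0 :=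
    ⟨R, hVzero⟩
  -- data closeness
  have hclose0 : ∀ x, ‖u₀ x - V 0 x‖ ≤ δ / 2 := fun x => (hdata x).trans hηle
  -- the improvement from QP3 (sup part)
  have himp : ∀ T' ∈ Ioc 0 T, ∀ (u : ℝ → EuclideanSpace ℝ (Fin 3) → EuclideanSpace ℝ (Fin 3))
      (p : ℝ → EuclideanSpace ℝ (Fin 3) → ℝ), TaoFrame T' u p → u 0 = u₀ →
      (∀ t ∈ Icc 0 T', ∀ x, ‖u t x - V t x‖ ≤ 2 * δ) →
      ∀ t ∈ Icc 0 T', ∀ x, ‖u t x - V t x‖ ≤ δ := by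
    intro T' hT' u p hframe hu0 hboot
    have hboot2 : ∀ t ∈ Icc 0 T', ∀ x, ‖u t x - V t x‖ ≤ 2 :=
      fun t ht x => (hboot t ht x).trans (by linarith)
    have h := (hsh ε hε (η₁ * ε ^ κ₃) hηpos.le V hVcont hVrate hVzero' hdef u₀ hdata T' hT' u p
      hframe hu0 hboot2).1
    intro t ht x
    have := h t ht x
    rw [hδw] at this
    linarith
  -- P2: the Tao-frame solution on [0, 1-ε]
  obtain ⟨u, p, hframe, hu0, hclose⟩ :=
    h4 T δ u₀ V hTpos hδ hu₀s hu₀d hu₀c hVcont hVbd hVdec hclose0 himp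
  -- QP3 on the full slab
  have hTmem : T ∈ Ioc 0 T := ⟨hTpos, le_rfl⟩
  have hboot2 : ∀ t ∈ Icc 0 T, ∀ x, ‖u t x - V t x‖ ≤ 2 :=
    fun t ht x => (hclose t ht x).trans (by linarith)
  obtain ⟨hsup, hL3w⟩ :=
    hsh ε hε (η₁ * ε ^ κ₃) hηpos.le V hVcont hVrate hVzero' hdef u₀ hdata T hTmem u p hframe hu0 hboot2
  have hsupδ : ∀ t ∈ Icc 0 T, ∀ x, ‖u t x - V t x‖ ≤ δ / 2 := by
    intro t ht x
    have := hsup t ht x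
    rwa [hδw] at this
  -- the internal budget at (R, ε) and the L³ size of w = u - V
  obtain ⟨bs, hbs0, hbscube, hbsv⟩ := hbud R hR2 ε ⟨hεpos, hεlt1.le⟩
  have hVb : ∀ t ∈ Icc 0 (1 - ε), eLpNorm (V t) 3 volume ≤ ENNReal.ofReal bs := by
    intro t ht
    refine (hVL3 t ht).trans (hbsv (t - 1) ?_)
    constructor <;> linarith [ht.1, ht.2]
  obtain ⟨hdataL3, hdefL3⟩ := hL3 bs hbs0 hbsv
  have hδw1 : K₃ * ε ^ (-κ₃) * (η₁ * ε ^ κ₃) ≤ 1 := by rw [hδw]; linarith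
  have hwL3 := hL3w (K₂ * (bs + 1)) bs (by positivity) hbs0 hδw1 hdataL3 hdefL3 hVb
  rw [hδw] at hwL3
  set k : ℝ := K₃ * (K₂ * (bs + 1) + bs * (δ / 2)) with hk
  have hk0 : 0 ≤ k := by positivity
  have hkc : k ≤ c * (bs + 1) := by
    rw [hk, hc]
    have h1 : K₂ * (bs + 1) + bs * (δ / 2) ≤ (K₂ + 2) * (bs + 1) := by nlinarith
    calc K₃ * (K₂ * (bs + 1) + bs * (δ / 2)) ≤ K₃ * ((K₂ + 2) * (bs + 1)) :=
          mul_le_mul_of_nonneg_left h1 (by linarith)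
      _ = K₃ * (K₂ + 2) * (bs + 1) := by ring
  -- assemble Q1 at this ε
  refine ⟨R, u, p, hR2, ?_, hframe, ?_, ⟨k, hk0, ?_, ?_⟩, ?_⟩
  · -- R ≤ K ε^{-κ}
    have hrK' : r ≤ K₁ * ε ^ (-κ₁) := by linarith
    have hεk₂ : 0 ≤ ε ^ (-k₂) := Real.rpow_nonneg hεpos.le _
    have hεκ₁ : 0 ≤ ε ^ (-κ₁) := Real.rpow_nonneg hεpos.le _
    have hrr : r * r ≤ (K₁ * ε ^ (-κ₁)) * (K₁ * ε ^ (-κ₁)) :=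
      mul_le_mul hrK' hrK' hrpos.le (by positivity)
    have hexp : ε ^ (-(k₂ + (κ₁ + κ₁))) = ε ^ (-k₂) * (ε ^ (-κ₁) * ε ^ (-κ₁)) := by
      rw [← Real.rpow_add hεpos, ← Real.rpow_add hεpos]; ring_nf
    calc R ≤ K₂ * ε ^ (-k₂) * (r * r) := hRhi
      _ ≤ K₂ * ε ^ (-k₂) * ((K₁ * ε ^ (-κ₁)) * (K₁ * ε ^ (-κ₁))) :=
          mul_le_mul_of_nonneg_left hrr (by positivity)
      _ = (K₂ * (K₁ * K₁)) * ε ^ (-(k₂ + (κ₁ + κ₁))) := by rw [hexp]; ring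
      _ ≤ max (K₂ * (K₁ * K₁)) (4 * (B + 1) * c ^ 3) * ε ^ (-(k₂ + (κ₁ + κ₁))) :=
          mul_le_mul_of_nonneg_right (le_max_left _ _) (Real.rpow_nonneg hεpos.le _)
  · -- (i) the virtual Type-I bound with constant M + 1
    intro t ht x
    have ht' : t ∈ Icc 0 T := by simpa [hT] using ht
    have h1t : 0 < 1 - t := by rw [hT] at ht'; linarith [ht'.2]
    have h1t' : 1 - t ≤ 1 := by linarith [ht'.1]
    have hone : (1 : ℝ) ≤ (1 - t) ^ (-(1 / 2 : ℝ)) :=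
      Real.one_le_rpow_of_pos_of_le_one_of_nonpos h1t h1t' (by norm_num)
    have hw : ‖u t x - V t x‖ ≤ δ / 2 := hsupδ t ht' x
    have hVx : ‖V t x‖ ≤ M * (1 - t) ^ (-(1 / 2 : ℝ)) := hVrate t ht' x
    have heq : (1 - ε + ε - t) = 1 - t := by ring
    rw [heq]
    calc ‖u t x‖ = ‖(u t x - V t x) + V t x‖ := by abel_nf
      _ ≤ ‖u t x - V t x‖ + ‖V t x‖ := norm_add_le _ _
      _ ≤ δ / 2 + M * (1 - t) ^ (-(1 / 2 : ℝ)) := by linarith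
      _ ≤ 1 * (1 - t) ^ (-(1 / 2 : ℝ)) + M * (1 - t) ^ (-(1 / 2 : ℝ)) := by nlinarith
      _ = (M + 1) * (1 - t) ^ (-(1 / 2 : ℝ)) := by ring
  · -- (ii) the cube-log shape of k
    have hlogR : 0 ≤ Real.log R := Real.log_nonneg (by linarith)
    have hlogε : 0 ≤ Real.log (1 / ε) := by
      apply Real.log_nonneg; rw [le_div_iff₀ hεpos]; linarith
    have hL : 1 ≤ 1 + Real.log R + Real.log (1 / ε) := by linarith
    have h1 : k ^ 3 ≤ (c * (bs + 1)) ^ 3 := by gcongr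
    have h2 : (bs + 1) ^ 3 ≤ 4 * bs ^ 3 + 4 * 1 ^ 3 := DyadicChaining.add_pow_three_le_four hbs0 zero_le_one
    have h3 : (c * (bs + 1)) ^ 3 = c ^ 3 * (bs + 1) ^ 3 := by ring
    have hc3 : 0 ≤ c ^ 3 := by positivity
    have h4 : c ^ 3 * (bs + 1) ^ 3 ≤ c ^ 3 * (4 * (B * (1 + Real.log R + Real.log (1 / ε)) + 1)) := by
      refine mul_le_mul_of_nonneg_left ?_ hc3
      calc (bs + 1) ^ 3 ≤ 4 * bs ^ 3 + 4 * 1 ^ 3 := h2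
        _ ≤ 4 * (B * (1 + Real.log R + Real.log (1 / ε)) + 1) := by
            simp only [one_pow]; linarith [hbscube]
    have h5' : c ^ 3 * 1 ≤ c ^ 3 * (1 + Real.log R + Real.log (1 / ε)) :=
      mul_le_mul_of_nonneg_left hL hc3
    have h5 : c ^ 3 * (4 * (B * (1 + Real.log R + Real.log (1 / ε)) + 1)) ≤
        4 * (B + 1) * c ^ 3 * (1 + Real.log R + Real.log (1 / ε)) := by
      have hexpand : 4 * (B + 1) * c ^ 3 * (1 + Real.log R + Real.log (1 / ε)) -
          c ^ 3 * (4 * (B * (1 + Real.log R + Real.log (1 / ε)) + 1)) =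
          4 * (c ^ 3 * (1 + Real.log R + Real.log (1 / ε)) - c ^ 3 * 1) := by ring
      linarith [hexpand, h5']
    have h6 : 4 * (B + 1) * c ^ 3 * (1 + Real.log R + Real.log (1 / ε)) ≤
        max (K₂ * (K₁ * K₁)) (4 * (B + 1) * c ^ 3) * (1 + Real.log R + Real.log (1 / ε)) :=
      mul_le_mul_of_nonneg_right (le_max_right _ _) (by linarith)
    calc k ^ 3 ≤ (c * (bs + 1)) ^ 3 := h1
      _ = c ^ 3 * (bs + 1) ^ 3 := h3
      _ ≤ _ := h4
      _ ≤ _ := h5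
      _ ≤ _ := h6
  · -- (ii) the L³ bound ‖u t‖₃ ≤ b + k for every admissible b
    intro b hb hbv t ht
    have ht' : t ∈ Icc 0 T := by simpa [hT] using ht
    have htε : t ∈ Icc 0 (1 - ε) := by simpa [hT] using ht'
    have hucont : Continuous (u t) :=
      (hframe.1.contDiff_velocity (by simpa [hT] using ht)).continuous
    have hVtcont : Continuous (fun x => V t x) := by
      have hc := hVcont.comp_continuous (f := fun x : EuclideanSpace ℝ (Fin 3) => (t, x))
        (by fun_prop) (fun x => ⟨htε, mem_univ _⟩)
      exact hc
    have hwcont : Continuous (fun x => u t x - V t x) := hucont.sub hVtcont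
    have hm1 : AEStronglyMeasurable (fun x => V t x) volume := hVtcont.aestronglyMeasurable
    have hm2 : AEStronglyMeasurable (fun x => u t x - V t x) volume := hwcont.aestronglyMeasurable
    have hsplit : u t = (fun x => V t x) + fun x => u t x - V t x := by
      funext x; simp
    have h3 : (1 : ℝ≥0∞) ≤ 3 := by norm_num
    have hVt : eLpNorm (fun x => V t x) 3 volume ≤ ENNReal.ofReal b := by
      have hs : t - 1 ∈ Icc (-1 : ℝ) (-ε) := by constructor <;> linarith [htε.1, htε.2]
      exact (hVL3 t htε).trans (hbv (t - 1) hs)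
    have hwt : eLpNorm (fun x => u t x - V t x) 3 volume ≤ ENNReal.ofReal k := hwL3 t ht'
    have step : eLpNorm ((fun x => V t x) + fun x => u t x - V t x) 3 volume ≤
        eLpNorm (fun x => V t x) 3 volume + eLpNorm (fun x => u t x - V t x) 3 volume :=
      eLpNorm_add_le hm1 hm2 h3
    have hfin : ENNReal.ofReal b + ENNReal.ofReal k = ENNReal.ofReal (b + k) :=
      (ENNReal.ofReal_add hb hk0).symm
    rw [hsplit]
    exact (step.trans (add_le_add hVt hwt)).trans hfin.le
  · -- (iii) δ-closeness on the unit ball at the final time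
    intro x hx
    have hTmem' : T ∈ Icc 0 T := ⟨hTpos.le, le_rfl⟩
    have hTε : T ∈ Icc 0 (1 - ε) := by simpa [hT] using hTmem'
    have hxr : ‖x‖ ≤ r := by
      have : ‖x‖ < 1 := by simpa using hx
      linarith
    have hVx : V T x = v (-ε) x := by
      have h := hVeq T hTε x hxr
      have : T - 1 = -ε := by rw [hT]; ring
      rw [this] at h
      exact h
    have h := hsupδ T hTmem' x
    rw [hVx] at h
    have hgoal : ‖u T x - v (-ε) x‖ ≤ δ := by linarith
    simpa [hT] using hgoal

/-- **Q1 from the log-weighted pieces and the landed P2 (PROVED composition).** [line quiet_collar; port] -/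
theorem stubQuietTruncation_of_anatomyLog (h1 : StubQuietCollarLog) (h2 : StubCutPairLog)
    (h3 : StubForcedTwoNormShadowing) (h4 : StubFrameBootstrap) : StubQuietTruncation :=
  fun M v hv hB => ⟨M, farFieldTruncation_of_quietAnatomyLog hv hB (h1 M v hv hB) (h2 M v hv hB) h3 h4⟩

/-- ★ **Q1 `StubQuietTruncation` BY NAME, UNCONDITIONAL**: quiet-collar truncation stability of the loop line
`quiet_collar`, from QP1-log (`stub_quietCollarLog`), QP2-log (`stub_cutPairLog`), QP3 (`stub_forcedTwoNormShadowing`)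
and P2 (`TruncationEdge.stub_frameBootstrap`), all tree theorems.  [line quiet_collar; port pub-ns-dss typer] -/
theorem stub_quietTruncation_log : StubQuietTruncation :=
  stubQuietTruncation_of_anatomyLog stub_quietCollarLog stub_cutPairLog stub_forcedTwoNormShadowing stub_frameBootstrap

end Summit.NavierStokesRegularity.NavierStokesRegularity.Cruxes.TypeIQuantSubcubicExp.QuietCollar

end
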